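import Literature.NumberTheory.Sieve.SmoothArcClasses
import HarnessLib

/-!
# Class-restricted smooth arc sums: the cancelling majorant of the principal-part error

Topic `Literature/NumberTheory/Sieve`; a PROVED algebraic tool file continuing `SmoothArcClasses`
([Harper2016, §2.2, §5], [MontgomeryVaughanActa1975, §5–6]). Notation: a modulus `m ≥ 1`, a class
`r (mod m)`, a denominator `k ≥ 1`, ANY integer numerator `h`, `L = lcm(k, m)`, and for `t (mod L)`
the gcd `g_t = (t, L)`.

In the fibre decomposition `classArcSum = ∑_{t mod L, t ≡ r (m)} e(ht/k) V(t)` of `SmoothArcClasses`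
the principal part of `V(t)` (`φ(L/g_t)⁻¹ U(X/g_t, L/g_t)`) depends on `t` ONLY through `g_t`, so the
fibres with a common gcd `g` should be summed together WITH their phases before any norm is taken.
This file introduces

* `classGcdSum m r k h g = C_g(h) = ∑_{t mod L, t ≡ r (m), (t, L) = g} e(ht/k)`, the phase sum of the
  fibres with gcd `g` (a Ramanujan-type sum; for `m = 1`, `(h, k) = 1` it is `c_{k/g}(h) = μ(k/g)`);
* `classLocalHc α m r k h = ∑_{g ∣ L} ‖C_g(h)‖ g^{−α} τ(L/g)/φ(L/g)`, the CANCELLING majorant of the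
  principal-part error (compare `classLocalH = ∑_t g_t^{−α} τ(L/g_t)/φ(L/g_t)`, which counts the
  fibres with gcd `g` instead of adding their phases);
* `sum_class_mul_apply_gcd_eq_sum_divisors`: `∑_{t} e(ht/k) F(g_t) = ∑_{g ∣ L} C_g(h) F(g)` for any `F`;
* `classLocalFactor_eq_sum_divisors`: the divisor form
  `classLocalFactor α m r k h = ∑_{g ∣ L} C_g(h) g^{−α} ∏_{p ∣ L/g}(1 − p^{−α})/φ(L/g)`;
* `norm_classLocalFactor_le`: `‖classLocalFactor α m r k h‖ ≤ classLocalHc α m r k h` for `α ≥ 0`;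
* small API: `classGcdSum_zero_of_not_dvd`, `classLocalHc_nonneg`, `prod_primeFactors_one_sub_rpow_mem_Icc`.

The pointwise class-arc estimate with this majorant is `SmoothArcClassesPointwise`; the CRT structure
of `C_g(h)` and `classLocalFactor` is developed elsewhere. Nothing here needs `k, m ≥ 1` (for `L = 0`
all the sums are empty).

## References

* A. J. Harper, Compositio Math. 152 (2016), §2.2, §5 [Harper2016].
* H. L. Montgomery, R. C. Vaughan, Acta Arith. 27 (1975), §5–6 [MontgomeryVaughanActa1975].
-/

noncomputable section

open Finset Real Complex
open scoped ArithmeticFunction.Moebius FourierTransform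

namespace Literature.NumberTheory.Sieve

namespace SmoothArcs

open MontgomeryVaughan1975 TwistedWeight

/-! ### The phase sums `C_g(h)` and the cancelling majorant -/

/-- The phase sum of the fibres with a given gcd: `C_g(h) = Σ_{t mod L, t ≡ r (m), gcd(t,L) = g} e(ht/k)`, `L = lcm(k,m)`.
[cite: MontgomeryVaughanActa1975, §5] -/
def classGcdSum (m r k : ℕ) (h : ℤ) (g : ℕ) : ℂ :=
  ∑ t ∈ (Finset.range (Nat.lcm k m)).filter (fun t => t ≡ r [MOD m] ∧ Nat.gcd t (Nat.lcm k m) = g),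
    (𝐞 ((h * t : ℝ) / k) : ℂ)

/-- The CANCELLING majorant of the principal-part error: `Σ_{g ∣ L} ‖C_g(h)‖ · g^{−α} τ(L/g)/φ(L/g)`.
[cite: Harper2016, §2.2] -/
def classLocalHc (α : ℝ) (m r k : ℕ) (h : ℤ) : ℝ :=
  ∑ g ∈ (Nat.lcm k m).divisors,
    ‖classGcdSum m r k h g‖ * (((g : ℕ) : ℝ) ^ (-α) * ((Nat.lcm k m / g).divisors.card : ℝ) / ((Nat.lcm k m / g).totient : ℝ))

/-- `C_g(h) = 0` unless `g ∣ L` (no `t` has `(t, L) = g`). [folklore] -/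
theorem classGcdSum_zero_of_not_dvd {m k g : ℕ} (hg : ¬ g ∣ Nat.lcm k m) (r : ℕ) (h : ℤ) :
    classGcdSum m r k h g = 0 := by
  unfold classGcdSum
  refine Finset.sum_eq_zero fun t ht => ?_
  obtain ⟨-, -, htg⟩ := Finset.mem_filter.mp ht
  exact absurd (htg ▸ Nat.gcd_dvd_right t (Nat.lcm k m)) hg

/-- `classLocalHc α m r k h ≥ 0`. [folklore] -/
theorem classLocalHc_nonneg (α : ℝ) (m r k : ℕ) (h : ℤ) : 0 ≤ classLocalHc α m r k h := by
  unfold classLocalHc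
  refine Finset.sum_nonneg fun g _ => mul_nonneg (norm_nonneg _) ?_
  exact div_nonneg (mul_nonneg (Real.rpow_nonneg (Nat.cast_nonneg g) _) (Nat.cast_nonneg _)) (Nat.cast_nonneg _)

/-! ### Grouping the classes `t` by `g = (t, L)` -/

/-- **Grouping by the gcd.** For any `F`:
`∑_{t mod L, t ≡ r (m)} e(ht/k) F((t, L)) = ∑_{g ∣ L} C_g(h) F(g)` (`L = lcm(k, m)`; both sides vanish for `L = 0`).
[folklore] -/
theorem sum_class_mul_apply_gcd_eq_sum_divisors (m r k : ℕ) (h : ℤ) (F : ℕ → ℂ) :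
    ∑ t ∈ (Finset.range (Nat.lcm k m)).filter (fun t => t ≡ r [MOD m]),
        (𝐞 ((h * t : ℝ) / k) : ℂ) * F (Nat.gcd t (Nat.lcm k m)) =
      ∑ g ∈ (Nat.lcm k m).divisors, classGcdSum m r k h g * F g := by
  rw [← Finset.sum_fiberwise_of_maps_to (g := fun t => Nat.gcd t (Nat.lcm k m)) (t := (Nat.lcm k m).divisors)]
  · refine Finset.sum_congr rfl fun g _ => ?_
    rw [classGcdSum, Finset.sum_mul, Finset.filter_filter]
    refine Finset.sum_congr rfl fun t ht => ?_
    obtain ⟨-, -, htg⟩ := Finset.mem_filter.mp ht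
    rw [htg]
  · intro t ht
    have htL : t < Nat.lcm k m := Finset.mem_range.mp (Finset.mem_filter.mp ht).1
    exact Nat.mem_divisors.mpr ⟨Nat.gcd_dvd_right t (Nat.lcm k m), by omega⟩

/-- **Divisor form of the local factor.**
`classLocalFactor α m r k h = ∑_{g ∣ L} C_g(h) · g^{−α} ∏_{p ∣ L/g}(1 − p^{−α})/φ(L/g)`. [cite: Harper2016, §2.2] -/
theorem classLocalFactor_eq_sum_divisors (α : ℝ) (m r k : ℕ) (h : ℤ) :
    classLocalFactor α m r k h =
      ∑ g ∈ (Nat.lcm k m).divisors, classGcdSum m r k h g *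
        ((((g : ℕ) : ℝ) ^ (-α) * (∏ p ∈ (Nat.lcm k m / g).primeFactors, (1 - (p : ℝ) ^ (-α))) /
          ((Nat.lcm k m / g).totient : ℝ) : ℝ) : ℂ) := by
  unfold classLocalFactor
  exact sum_class_mul_apply_gcd_eq_sum_divisors m r k h
    (fun g => ((((g : ℕ) : ℝ) ^ (-α) * (∏ p ∈ (Nat.lcm k m / g).primeFactors, (1 - (p : ℝ) ^ (-α))) /
      ((Nat.lcm k m / g).totient : ℝ) : ℝ) : ℂ))

/-- `0 ≤ ∏_{p ∣ n} (1 − p^{−α}) ≤ 1` for `α ≥ 0`. [folklore] -/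
theorem prod_primeFactors_one_sub_rpow_mem_Icc {α : ℝ} (hα : 0 ≤ α) (n : ℕ) :
    (∏ p ∈ n.primeFactors, (1 - (p : ℝ) ^ (-α))) ∈ Set.Icc (0 : ℝ) 1 := by
  have h1 : ∀ p ∈ n.primeFactors, (p : ℝ) ^ (-α) ≤ 1 := fun p hp =>
    Real.rpow_le_one_of_one_le_of_nonpos (by exact_mod_cast (Nat.prime_of_mem_primeFactors hp).one_lt.le)
      (by linarith)
  have h0 : ∀ p ∈ n.primeFactors, 0 ≤ (p : ℝ) ^ (-α) := fun p _ => Real.rpow_nonneg (Nat.cast_nonneg p) _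
  exact ⟨Finset.prod_nonneg fun p hp => by linarith [h1 p hp],
    Finset.prod_le_one (fun p hp => by linarith [h1 p hp]) fun p hp => by linarith [h0 p hp]⟩

/-- **The local factor is dominated by the cancelling majorant**: `‖classLocalFactor α m r k h‖ ≤ classLocalHc α m r k h`
for `α ≥ 0` (termwise `|∏_{p ∣ L/g}(1 − p^{−α})| ≤ 1 ≤ τ(L/g)`). [cite: Harper2016, §2.2] -/
theorem norm_classLocalFactor_le {α : ℝ} (hα : 0 ≤ α) (m r k : ℕ) (h : ℤ) :
    ‖classLocalFactor α m r k h‖ ≤ classLocalHc α m r k h := by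
  rw [classLocalFactor_eq_sum_divisors, classLocalHc]
  refine (norm_sum_le _ _).trans (Finset.sum_le_sum fun g hg => ?_)
  rw [norm_mul, Complex.norm_real, Real.norm_eq_abs]
  refine mul_le_mul_of_nonneg_left ?_ (norm_nonneg _)
  set n : ℕ := Nat.lcm k m / g
  have hn0 : n ≠ 0 := by
    obtain ⟨hgL, hL0⟩ := Nat.mem_divisors.mp hg
    exact (Nat.div_ne_zero_iff_of_dvd hgL).mpr ⟨hL0, (Nat.pos_of_mem_divisors hg).ne'⟩
  have hgα : 0 ≤ ((g : ℕ) : ℝ) ^ (-α) := Real.rpow_nonneg (Nat.cast_nonneg g) _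
  have hφ : 0 ≤ (n.totient : ℝ) := Nat.cast_nonneg _
  obtain ⟨hP0, hP1⟩ := prod_primeFactors_one_sub_rpow_mem_Icc hα n
  have hτ : (1 : ℝ) ≤ (n.divisors.card : ℝ) := by
    exact_mod_cast Finset.card_pos.mpr ⟨1, Nat.one_mem_divisors.mpr hn0⟩
  rw [abs_div, abs_mul, abs_of_nonneg hgα, abs_of_nonneg hP0, Nat.abs_cast]
  exact div_le_div_of_nonneg_right (mul_le_mul_of_nonneg_left (hP1.trans hτ) hgα) hφ

end SmoothArcs

end Literature.NumberTheory.Sieve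

end
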